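import Summits.Ventures.PercRepro.ProfilePointedCircuitClassesBadPairs

/-!
# PercRepro — THE SINGLE-TRIANGLE CASE OF `InOutBottomFour`, I: THE MIXED FAMILY `(f, g)` OF A NULLITY-3 MATROID CLIMBS
FROM ITS BOTTOM — `v_2(f, g) ≤ v_4(f, g)` FOR `#E ≥ 10` (p5, gen 38; `proofs/P5-GM1.md` §54 ADDENDA 2–3)

For a nullity-3 matroid `M` (`#E = ρ + 3`), two points `f ≠ g` with `g` not a coloop, and `H₀ := E − f − g`, the
mixed family `v_s(f, g) := #{Y ⊆ H₀ : #Y = s, Y + f ∈ ℐ, (H₀ − Y) + g ∈ ℐ}` satisfies `v_2 ≤ v_4` as soon as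
`ρ ≥ 7`: every demand `Y` has at least `(ρ − 3)(ρ − 4)／2 ≥ 6` extensions `Y + c + d` with `Y + f + c + d ∈ ℐ`
(the «bad» pairs `{c, d} ⊆ S := H₀ − Y` number at most `C(ρ − 1, 2) − C(ρ − 1 − #K, 2) + C(3 − #K, 2)`, where
`K := S ∩ cl(Y + f)` has at most two points and the bad pairs inside `S − K` are the «parallel pairs modulo
`Y + f`» of a set of nullity `2 − #K`), while a unit `Z` contains at most `C(4, 2) = 6` pairs.  This is one of the
three pieces of the single-triangle case `(★_2)` of the open inequality (the other two: the same statement with `f`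
and `g` exchanged, and the «bottom ≤ top − 2» comparison `(G)` of the family marked by `{f, g}` on one side).

* **`mixedTwo_le_mixedFour_of_nullity_three`** (the parallel-pairs bound `card_filter_bad_pairs_le` is in
  ProfilePointedCircuitClassesBadPairs).
-/

open scoped Matroid

namespace PercRepro.Cogirth

open Finset ThmH Skew Shadow Profile

variable {α : Type} [DecidableEq α] {M : Matroid α} [M.Finite]

section MixedTwoFour

/-- **THE MIXED FAMILY `(f, g)` OF A NULLITY-3 MATROID CLIMBS FROM ITS BOTTOM**: on `#E = ρ(E) + 3`, `ρ(E) ≥ 7`, for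
`f ≠ g` with `g` not a coloop and `H₀ := E − f − g`,
`#{Y ⊆ H₀ : #Y = 2, Y + f ∈ ℐ, (H₀ − Y) + g ∈ ℐ} ≤ #{Y ⊆ H₀ : #Y = 4, Y + f ∈ ℐ, (H₀ − Y) + g ∈ ℐ}`
(the containment double counting of §54 ADDENDUM 3 (1): at least `C(ρ − 1 − #K, 2) − C(3 − #K, 2) ≥ 6` extensions
per demand, at most `6` demands per unit). -/
theorem mixedTwo_le_mixedFour_of_nullity_three (hn : (gr M).card = rk M (gr M) + 3) (hR : 7 ≤ rk M (gr M))
    {f g : α} (hf : f ∈ gr M) (hg : g ∈ gr M) (hfg : f ≠ g) (hgc : rk M ((gr M).erase g) = rk M (gr M)) :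
    (((((gr M).erase f).erase g).powersetCard 2).filter (fun Y => rk M (insert f Y) = 3 ∧
        rk M (insert g (((gr M).erase f).erase g \ Y)) = (insert g (((gr M).erase f).erase g \ Y)).card)).card ≤
    (((((gr M).erase f).erase g).powersetCard 4).filter (fun Y => rk M (insert f Y) = 5 ∧
        rk M (insert g (((gr M).erase f).erase g \ Y)) = (insert g (((gr M).erase f).erase g \ Y)).card)).card := by
  obtain ⟨H₀, hH₀⟩ : ∃ H₀ : Finset α, H₀ = ((gr M).erase f).erase g := ⟨_, rfl⟩
  rw [← hH₀]
  have hH₀g : H₀ ⊆ gr M := by rw [hH₀]; exact (erase_subset _ _).trans (erase_subset _ _)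
  have hfH₀ : f ∉ H₀ := by
    rw [hH₀]
    intro h
    exact (mem_erase.1 (erase_subset _ _ h)).1 rfl
  have hgH₀ : g ∉ H₀ := by
    rw [hH₀]
    intro h
    exact (mem_erase.1 h).1 rfl
  have hH₀card : H₀.card = rk M (gr M) + 1 := by
    rw [hH₀, card_erase_of_mem (mem_erase.2 ⟨hfg.symm, hg⟩), card_erase_of_mem hf]
    omega
  have hgrE : (gr M).erase g = insert f H₀ := by
    rw [hH₀]
    ext a
    simp only [mem_erase, mem_insert]
    constructor
    · rintro ⟨hag, hag'⟩
      by_cases haf : a = f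
      · exact Or.inl haf
      · exact Or.inr ⟨hag, haf, hag'⟩
    · rintro (rfl | ⟨hag, _, hag'⟩)
      · exact ⟨hfg, hf⟩
      · exact ⟨hag, hag'⟩
  obtain ⟨D, hD⟩ : ∃ D : Finset (Finset α), D = (H₀.powersetCard 2).filter (fun Y => rk M (insert f Y) = 3 ∧
      rk M (insert g (H₀ \ Y)) = (insert g (H₀ \ Y)).card) := ⟨_, rfl⟩
  obtain ⟨U, hU⟩ : ∃ U : Finset (Finset α), U = (H₀.powersetCard 4).filter (fun Y => rk M (insert f Y) = 5 ∧
      rk M (insert g (H₀ \ Y)) = (insert g (H₀ \ Y)).card) := ⟨_, rfl⟩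
  rw [← hD, ← hU]
  -- every demand has at least `6` units above it
  have hdeg : ∀ Y ∈ D, 6 ≤ (U.filter (fun Z => Y ⊆ Z)).card := by
    intro Y hY
    rw [hD, mem_filter, mem_powersetCard] at hY
    obtain ⟨⟨hYH, hY2⟩, hYf, hYg⟩ := hY
    obtain ⟨S, hS⟩ : ∃ S : Finset α, S = H₀ \ Y := ⟨_, rfl⟩
    rw [← hS] at hYg
    have hSH : S ⊆ H₀ := by rw [hS]; exact sdiff_subset
    have hSg : S ⊆ gr M := hSH.trans hH₀g
    have hScard : S.card = rk M (gr M) - 1 := by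
      rw [hS, card_sdiff_of_subset hYH, hH₀card, hY2]
      omega
    have hgS : g ∉ S := fun h => hgH₀ (hSH h)
    have hSrk : rk M S = S.card := rk_eq_card_of_subset_of_rk_eq_card (subset_insert g S) hYg
    obtain ⟨Yf, hYf'⟩ : ∃ Yf : Finset α, Yf = insert f Y := ⟨_, rfl⟩
    rw [← hYf'] at hYf
    have hYfg : Yf ⊆ gr M := by rw [hYf']; exact insert_subset hf (hYH.trans hH₀g)
    have hfY : f ∉ Y := fun h => hfH₀ (hYH h)
    have hYfcard : Yf.card = 3 := by rw [hYf', card_insert_of_notMem hfY, hY2]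
    have hYfS : Yf ∪ S = (gr M).erase g := by
      rw [hgrE, hYf', hS]
      ext a
      simp only [mem_union, mem_insert, mem_sdiff]
      constructor
      · rintro ((rfl | haY) | ⟨haH, _⟩)
        · exact Or.inl rfl
        · exact Or.inr (hYH haY)
        · exact Or.inr haH
      · rintro (rfl | haH)
        · exact Or.inl (Or.inl rfl)
        · by_cases haY : a ∈ Y
          · exact Or.inl (Or.inr haY)
          · exact Or.inr ⟨haH, haY⟩
    have hYfSrk : rk M (Yf ∪ S) = rk M (gr M) := by rw [hYfS, hgc]
    -- `K`: the points of `S` in `cl(Yf)`; at most two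
    obtain ⟨K, hK⟩ : ∃ K : Finset α, K = S.filter (fun a => a ∈ clF M Yf) := ⟨_, rfl⟩
    have hKS : K ⊆ S := by rw [hK]; exact filter_subset _ _
    have hKcl : ∀ a ∈ K, a ∈ clF M Yf := by intro a ha; rw [hK, mem_filter] at ha; exact ha.2
    have hKcard : K.card ≤ 2 := by
      by_contra hcon
      obtain ⟨A, hAK, hA3⟩ := exists_subset_card_eq (show 3 ≤ K.card by omega)
      have hAS : A ⊆ S := hAK.trans hKS
      have hAg : A ⊆ gr M := hAS.trans hSg
      have hArk : rk M A = 3 := by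
        have := rk_eq_card_of_subset_of_rk_eq_card hAS hSrk
        rwa [hA3] at this
      have hYfA : rk M (Yf ∪ A) = 3 := by
        have h1 : Yf ∪ A ⊆ clF M Yf :=
          union_subset (fun w hw => mem_clF_of_mem_of_subset_gr hYfg hw) (fun a ha => hKcl a (hAK ha))
        have h2 := rk_le_rk_of_subset_finset (M := M) h1
        rw [rk_clF_eq_rk, hYf] at h2
        have h3 := rk_le_rk_of_subset_finset (M := M) (subset_union_left (s₁ := Yf) (s₂ := A))
        rw [hYf] at h3
        omega
      have hYfclS : Yf ⊆ clF M S := by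
        intro w hw
        have hwA : w ∈ clF M A := by
          rw [mem_clF_iff_rk_insert_eq (hYfg hw) hAg]
          have h1 := rk_le_rk_of_subset_finset (M := M)
            (insert_subset (mem_union_left A hw) (subset_union_right (s₁ := Yf) (s₂ := A)))
          have h2 := rk_le_rk_of_subset_finset (M := M) (subset_insert w A)
          omega
        exact mem_clF_of_subset hAS hwA
      have h1 : Yf ∪ S ⊆ clF M S := union_subset hYfclS (fun a ha => mem_clF_of_mem_of_subset_gr hSg ha)
      have h2 := rk_le_rk_of_subset_finset (M := M) h1
      rw [rk_clF_eq_rk, hSrk, hScard, hYfSrk] at h2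
      omega
    -- `Z := S − K`, of nullity `2 − #K` modulo `Yf`
    obtain ⟨Z, hZ⟩ : ∃ Z : Finset α, Z = S \ K := ⟨_, rfl⟩
    have hZS : Z ⊆ S := by rw [hZ]; exact sdiff_subset
    have hZg : Z ⊆ gr M := hZS.trans hSg
    have hZcl : ∀ z ∈ Z, z ∉ clF M Yf := by
      intro z hz
      rw [hZ, mem_sdiff] at hz
      intro hcl
      exact hz.2 (by rw [hK, mem_filter]; exact ⟨hz.1, hcl⟩)
    have hZcard : Z.card = S.card - K.card := by rw [hZ, card_sdiff_of_subset hKS]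
    have hYfZrk : rk M (Yf ∪ Z) = rk M (gr M) := by
      apply le_antisymm (rk_le_rk_gr (union_subset hYfg hZg))
      have hsub : Yf ∪ S ⊆ clF M (Yf ∪ Z) := by
        intro a ha
        rw [mem_union] at ha
        rcases ha with h | h
        · exact mem_clF_of_mem_of_subset_gr (union_subset hYfg hZg) (mem_union_left _ h)
        · by_cases haK : a ∈ K
          · exact mem_clF_of_subset subset_union_left (hKcl a haK)
          · exact mem_clF_of_mem_of_subset_gr (union_subset hYfg hZg)
              (mem_union_right _ (by rw [hZ, mem_sdiff]; exact ⟨h, haK⟩))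
      have := rk_le_rk_of_subset_finset (M := M) hsub
      rwa [rk_clF_eq_rk, hYfSrk] at this
    have hbad := card_filter_bad_pairs_le Yf hYfg (2 - K.card) Z hZg hZcl (by rw [hYfZrk, hYf, hZcard, hScard]; omega)
    -- the good pairs of `Z` are the complement of the bad ones
    obtain ⟨GP, hGP⟩ : ∃ GP : Finset (Finset α), GP = (Z.powersetCard 2).filter (fun p => rk M (Yf ∪ p) = 5) := ⟨_, rfl⟩
    have hGPcard : (Z.card.choose 2) ≤ GP.card + (3 - K.card).choose 2 := by
      have hsplit := card_filter_add_card_filter_not (s := Z.powersetCard 2) (p := fun p => rk M (Yf ∪ p) = rk M Yf + 1)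
      rw [card_powersetCard] at hsplit
      have hsub : (Z.powersetCard 2).filter (fun p => ¬ rk M (Yf ∪ p) = rk M Yf + 1) ⊆ GP := by
        intro p hp
        rw [mem_filter, mem_powersetCard] at hp
        obtain ⟨⟨hpZ, hp2⟩, hne⟩ := hp
        rw [hGP, mem_filter, mem_powersetCard]
        refine ⟨⟨hpZ, hp2⟩, ?_⟩
        obtain ⟨c, d, hcd, rfl⟩ := card_eq_two.1 hp2
        have hcZ : c ∈ Z := hpZ (mem_insert_self _ _)
        have h1 := rk_union_le (M := M) Yf {c, d}
        have h2 := rk_le_card (M := M) ({c, d} : Finset α)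
        rw [card_pair hcd] at h2
        have h3 : rk M (insert c Yf) = 4 := by
          rw [rk_insert_eq (hZg hcZ) hYfg, if_neg (hZcl c hcZ), hYf]
        have h4 := rk_le_rk_of_subset_finset (M := M)
          (insert_subset (mem_union_right Yf (mem_insert_self c {d})) (subset_union_left (s₁ := Yf) (s₂ := {c, d})))
        rw [hYf] at hne h1
        omega
      have h5 := card_le_card hsub
      have h6 : (2 - K.card + 1).choose 2 = (3 - K.card).choose 2 := by
        congr 1
        omega
      rw [h6] at hbad
      omega
    -- each good pair gives a unit above `Y`
    have hmaps : ∀ p ∈ GP, Y ∪ p ∈ U.filter (fun Z => Y ⊆ Z) := by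
      intro p hp
      rw [hGP, mem_filter, mem_powersetCard] at hp
      obtain ⟨⟨hpZ, hp2⟩, hrk⟩ := hp
      have hpS : p ⊆ S := hpZ.trans hZS
      have hpY : Disjoint Y p := by
        rw [disjoint_left]
        intro a haY hap
        have := hpS hap
        rw [hS, mem_sdiff] at this
        exact this.2 haY
      rw [mem_filter, hU, mem_filter, mem_powersetCard]
      refine ⟨⟨⟨union_subset hYH (hpS.trans hSH), ?_⟩, ?_, ?_⟩, subset_union_left⟩
      · rw [card_union_of_disjoint hpY, hY2, hp2]
      · have e1 : insert f (Y ∪ p) = Yf ∪ p := by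
          rw [hYf']
          ext a
          simp only [mem_insert, mem_union]
          tauto
        rw [e1, hrk]
      · have e2 : H₀ \ (Y ∪ p) = S \ p := by
          rw [hS]
          ext a
          simp only [mem_sdiff, mem_union, not_or]
          tauto
        rw [e2]
        exact rk_eq_card_of_subset_of_rk_eq_card (insert_subset_insert g sdiff_subset) hYg
    have hinj : Set.InjOn (fun p => Y ∪ p) (GP : Set (Finset α)) := by
      intro p hp q hq hpq
      rw [mem_coe, hGP, mem_filter, mem_powersetCard] at hp hq
      have hpS : p ⊆ S := hp.1.1.trans hZS
      have hqS : q ⊆ S := hq.1.1.trans hZS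
      simp only at hpq
      have e1 : (Y ∪ p) \ Y = p := by
        ext a
        simp only [mem_sdiff, mem_union]
        constructor
        · rintro ⟨h, haY⟩
          exact h.resolve_left haY
        · intro hap
          have := hpS hap
          rw [hS, mem_sdiff] at this
          exact ⟨Or.inr hap, this.2⟩
      have e2 : (Y ∪ q) \ Y = q := by
        ext a
        simp only [mem_sdiff, mem_union]
        constructor
        · rintro ⟨h, haY⟩
          exact h.resolve_left haY
        · intro haq
          have := hqS haq
          rw [hS, mem_sdiff] at this
          exact ⟨Or.inr haq, this.2⟩
      rw [← e1, ← e2, hpq]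
    have h7 : GP.card ≤ (U.filter (fun Z => Y ⊆ Z)).card := card_le_card_of_injOn _ hmaps hinj
    -- the arithmetic: `C(ρ − 1 − #K, 2) − C(3 − #K, 2) ≥ 6`
    have hZc : Z.card = rk M (gr M) - 1 - K.card := by rw [hZcard, hScard]
    have h8 : 6 + (3 - K.card).choose 2 ≤ Z.card.choose 2 := by
      rw [hZc]
      have hmono : (6 - K.card).choose 2 ≤ (rk M (gr M) - 1 - K.card).choose 2 :=
        Nat.choose_le_choose 2 (by omega)
      have hK0 : K.card = 0 ∨ K.card = 1 ∨ K.card = 2 := by omega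
      rcases hK0 with h0 | h1 | h2
      · rw [h0] at hmono ⊢
        have e1 : Nat.choose (6 - 0) 2 = 15 := by decide
        have e2 : Nat.choose (3 - 0) 2 = 3 := by decide
        omega
      · rw [h1] at hmono ⊢
        have e1 : Nat.choose (6 - 1) 2 = 10 := by decide
        have e2 : Nat.choose (3 - 1) 2 = 1 := by decide
        omega
      · rw [h2] at hmono ⊢
        have e1 : Nat.choose (6 - 2) 2 = 6 := by decide
        have e2 : Nat.choose (3 - 2) 2 = 0 := by decide
        omega
    omega
  -- every unit has at most `6` demands inside it
  have hco : ∀ Z ∈ U, (D.filter (fun Y => Y ⊆ Z)).card ≤ 6 := by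
    intro Z hZ
    rw [hU, mem_filter, mem_powersetCard] at hZ
    obtain ⟨⟨hZH, hZ4⟩, _, _⟩ := hZ
    have hsub : D.filter (fun Y => Y ⊆ Z) ⊆ Z.powersetCard 2 := by
      intro Y hY
      rw [mem_filter] at hY
      obtain ⟨hYD, hYZ⟩ := hY
      rw [hD, mem_filter, mem_powersetCard] at hYD
      rw [mem_powersetCard]
      exact ⟨hYZ, hYD.1.2⟩
    calc (D.filter (fun Y => Y ⊆ Z)).card ≤ (Z.powersetCard 2).card := card_le_card hsub
      _ = 6 := by rw [card_powersetCard, hZ4]; decide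
  -- the double counting
  have h := sum_card_bipartiteAbove_eq_sum_card_bipartiteBelow (r := fun (Y Z : Finset α) => Y ⊆ Z) (s := D) (t := U)
  simp only [bipartiteAbove, bipartiteBelow] at h
  have h1 : D.card * 6 ≤ ∑ Y ∈ D, (U.filter (fun Z => Y ⊆ Z)).card := by
    rw [← smul_eq_mul]
    exact card_nsmul_le_sum _ _ _ hdeg
  have h2 : ∑ Z ∈ U, (D.filter (fun Y => Y ⊆ Z)).card ≤ U.card * 6 := by
    rw [← smul_eq_mul]
    exact sum_le_card_nsmul _ _ _ hco
  omega

end MixedTwoFour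

end PercRepro.Cogirth
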